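import Mathlib

/-!
# Venture AbcShadow — SH-01 STATEMENT: `xⁿ + yⁿ = C·z³`, `C ∈ {6, 12, 18, 36}`, every prime `n ≥ 5`

HONEST FRAMING. Statement file of the work-bound cell `abc-shadow` (row SH-01 of its census; typer seat
`abc-shadow-typ-1`). This file PROVES NOTHING about the equation: it types the TARGET of the row as a plain `Prop`
(`NoPrimitiveSolution`, `SH01`) in the binder style of the sister venture `Summits/Ventures/AbcSig/Rows/Statements.lean`,
together with the print convention "primitive solution" for signature `(n, n, 3)` (`IsPrimitiveSolution`, [BVY04, p. 1401]).
ADJACENT result (generalized Fermat, signature `(n, n, 3)`), NOT abc: nothing here is a claim on the abc conjecture or on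
any summit, and nothing here takes a side on IUT. The row theorem (`SH01/Row.lean`) derives `SH01` from NAMED print
hypotheses ([BVY04] = Bennett–Vatsal–Yazdani 2004) and one COMPUTED hypothesis (the newform data of level 972).

In print: [Kra11, Thm 1.1] (K. Krawciów, Colloq. Math. 123 (2011) 49–52) proves the statement for prime `n > M̃^{10M̃²}`
(`= 6³⁶⁰` here); `SH01` is the sharpening "every prime `n ≥ 5`".

Conventions. For `C ∈ {6, 12, 18, 36}` a solution with `x y z ≠ 0` automatically has `|xy| > 1` (if `|x| = |y| = 1` then
`xⁿ + yⁿ ∈ {0, ±2}` is not `C z³` with `z ≠ 0`), so the print side condition `|xy| > 1` / "non-trivial" is subsumed by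
`x * y * z ≠ 0`; see `SH01/Row.lean` for the one-line argument where it is used.
-/

namespace Summit.Ventures.AbcShadow

/-- **Primitive solution, signature `(n, n, 3)`** [cite: BennettVatsalYazdani2004, §2 p.1401]: "`A aⁿ + B bⁿ = C c³` …
Assume `Aa`, `Bb`, and `Cc` are pairwise coprime" with `Aa`, `Bb`, `Cc` nonzero — the `(n, n, 3)` analogue of
`Summit.Ventures.AbcSig.IsPrimitiveSolution` (same seven conjuncts, `c³` in place of `c²`). -/
def IsPrimitiveSolution (A B C : ℕ) (n : ℕ) (a b c : ℤ) : Prop :=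
  (A : ℤ) * a ^ n + (B : ℤ) * b ^ n = (C : ℤ) * c ^ 3 ∧
    (A : ℤ) * a ≠ 0 ∧ (B : ℤ) * b ≠ 0 ∧ (C : ℤ) * c ≠ 0 ∧
    IsCoprime ((A : ℤ) * a) ((B : ℤ) * b) ∧ IsCoprime ((A : ℤ) * a) ((C : ℤ) * c) ∧
    IsCoprime ((B : ℤ) * b) ((C : ℤ) * c)

/-- **SH-01 target, one pair `(C, n)`** [cite: Krawciow2011, Thm 1.1 (sharpened exponent range)]: the equation
`xⁿ + yⁿ = C z³` has NO solution in integers `x, y, z` with `x, y, C z` pairwise coprime and `x y z ≠ 0`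
(a "non-trivial primitive solution"). Plain `Prop` over `ℤ`/`ℕ`; nothing is asserted. -/
def NoPrimitiveSolution (C n : ℕ) : Prop :=
  ∀ x y z : ℤ, x ^ n + y ^ n = (C : ℤ) * z ^ 3 →
    IsCoprime x y → IsCoprime x ((C : ℤ) * z) → IsCoprime y ((C : ℤ) * z) → x * y * z ≠ 0 → False

/-- **SH-01** (census row of the cell `abc-shadow`) [cite: Krawciow2011, Thm 1.1 (print: `n > 6³⁶⁰`; here every prime
`n ≥ 5`)]: for every `C ∈ {6, 12, 18, 36}` and every prime `n ≥ 5`, `xⁿ + yⁿ = C z³` has no non-trivial primitive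
solution. This is the TARGET `Prop`; the conditional derivation is `SH01/Row.lean`. ADJACENT, NOT abc. -/
def SH01 : Prop :=
  ∀ C ∈ ({6, 12, 18, 36} : Finset ℕ), ∀ n : ℕ, n.Prime → 5 ≤ n → NoPrimitiveSolution C n

/-- Bookkeeping [folklore]: for `C ≠ 0`, `NoPrimitiveSolution C n` is literally "no `IsPrimitiveSolution 1 1 C n x y z`"
(the print convention with `A = B = 1`). (For `C = 0` the two differ: `IsCoprime x 0` only says `x = ±1`.) -/
theorem noPrimitiveSolution_iff (C n : ℕ) (hC : C ≠ 0) :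
    NoPrimitiveSolution C n ↔ ∀ x y z : ℤ, ¬ IsPrimitiveSolution 1 1 C n x y z := by
  constructor
  · rintro h x y z ⟨heq, hx, hy, hz, hxy, hxz, hyz⟩
    simp only [Nat.cast_one, one_mul] at heq hx hy hxy hxz hyz
    refine h x y z heq hxy hxz hyz ?_
    have hz' : z ≠ 0 := by
      rintro rfl
      exact hz (by simp)
    exact mul_ne_zero (mul_ne_zero hx hy) hz'
  · intro h x y z heq hxy hxz hyz hne
    have hx : x ≠ 0 := fun h0 => hne (by simp [h0])
    have hy : y ≠ 0 := fun h0 => hne (by simp [h0])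
    have hz : z ≠ 0 := fun h0 => hne (by simp [h0])
    have hC' : (C : ℤ) ≠ 0 := by exact_mod_cast hC
    exact h x y z ⟨by simpa using heq, by simpa using hx, by simpa using hy, mul_ne_zero hC' hz,
      by simpa using hxy, by simpa using hxz, by simpa using hyz⟩

end Summit.Ventures.AbcShadow
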